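import Summits.MatrixMultiplication.OmegaCensus.PeriodicBoxWindow
import Summits.MatrixMultiplication.OmegaCensus.DicyclicLawReduction
import Summits.MatrixMultiplication.OmegaCensus.DicyclicExactTiling
import Summits.MatrixMultiplication.OmegaCensus.DihedralLikeVertexCounting
import HarnessLib

/-!
# Class N2 (`(1,1),(a,a+1),(4,4)`) of the dicyclic-law triples: `U` is `ρ(c₀)`-stable, hence no such triple when
# `A/⟨c₀⟩` is a `2`-group mapping onto `𝔽₂³`

ω-census `pub-omega`, family (b3), seat pub-omega-group gen 12.  Framing: lottery ticket; floor = certified bounds/negative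
ranges.  VALUE: kernel theorems about the group-theoretic method (TPP capacity of dihedral-like groups); NOT progress on ω.

Dicyclic type `G(A, c₀)` (`c₀ ≠ 0`), `π : A →+ B` onto with kernel `{0, c₀}`, `B` a `2`-group (`2^m · B = 0`).

* `periodic_of_even_fibres`: a subset of `A` all of whose `π`-fibre counts are even is `c₀`-periodic.
* `even_of_odd_weight_convolution` (the odd-weight transfer, `𝔽₂[B]`-unit trick of `ParityWindowLemma.lean`): if
  `Y ⊆ A` has odd size and `H : B → ℕ` satisfies `∑_{y ∈ Y} H(z − π y) ≡ 0 (mod 2)` for every `z`, then every `H z` is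
  even (the element `∑_{y∈Y} X^{π y}` of `𝔽₂[B]` has odd weight, hence is a unit by Frobenius).
* `periodic_of_periodic_box_odd`: consequently an injective, `c₀`-periodic box `{s} + Y + W` with `|Y|` odd has `W`
  `c₀`-periodic.
* `n2_parts_periodic_aux`: in a TPP triple with `|S₀| = |S₁| = 1`, `|T₁|` odd and the vertex `111` exact, the boxes
  `S₀ + T₁ + U₁` and `S₁ + T₁ + U₀` are periodic (`periodic_of_exact_vertex`), so `U₀` and `U₁` are `c₀`-periodic, i.e.
  `U ρ(c₀) = U`.
* **`no_n2_dicyclic_law`**: dicyclic type, `|A| ≡ 2 (mod 3)`, `|A| ≥ 28`, `A/⟨c₀⟩ ↠ 𝔽₂³` and a `2`-group: no TPP triple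
  with `|S₀| = |S₁| = 1`, `|U₀| = |U₁| = 4` attains `3|S||T||U| + 16 = 8|A|` (vertex counting gives `{|T₀|,|T₁|} = {a, a+1}`
  with `a` even, so after a `τ0`-translation of `T` the auxiliary lemma applies and `no_dicyclic_law_of_stable_member`
  concludes).  This is the N2 shape class of `pub-omega-group-g11/FAMILY-B-ADDENDUM-g11.md` §2; with P1
  (`no_two_domino_dicyclic_law_of_rank_three`) and N3 (`no_n3_dicyclic_law`) three of the five classes are now kernel-dead
  for these quotients; B and N1 remain.
-/

namespace Summit.MatrixMultiplication.OmegaCensus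

open Literature.Combinatorics.Additive Finset AddMonoidAlgebra

/-! ## The odd-weight transfer -/

section OddTransfer

variable {A : Type} [AddCommGroup A] [Fintype A] [DecidableEq A] {B : Type} [AddCommGroup B] [Fintype B]
  [DecidableEq B]

omit [Fintype A] [Fintype B] in
/-- A subset of `A` all of whose `π`-fibre counts are even (`ker π = {0, c₀}`, `c₀ ≠ 0`) is `c₀`-periodic: the fibre of
`e ∈ E` is contained in `{e, e + c₀}`, is even and non-empty, so it contains `e + c₀`. [folklore] -/
theorem periodic_of_even_fibres (π : A →+ B) {c₀ : A} (hker : ∀ a : A, π a = 0 ↔ a = 0 ∨ a = c₀) (hc₀ : c₀ ≠ 0)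
    {E : Finset A} (h : ∀ y : B, 2 ∣ (E.filter fun a => π a = y).card) : E.image (· + c₀) = E := by
  have hπc : π c₀ = 0 := (hker c₀).2 (Or.inr rfl)
  apply eq_of_subset_of_card_le _ (by rw [card_image_of_injective _ (add_left_injective c₀)])
  intro x hx
  obtain ⟨e, he, rfl⟩ := mem_image.1 hx
  -- the fibre of `e`
  set F := E.filter fun a => π a = π e with hF
  have heF : e ∈ F := mem_filter.2 ⟨he, rfl⟩
  have hsub : F ⊆ {e, e + c₀} := by
    intro a ha
    obtain ⟨-, hae⟩ := mem_filter.1 ha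
    rw [mem_insert, mem_singleton]
    rcases (hker (a - e)).1 (by rw [map_sub, hae, sub_self]) with h0 | h0
    · exact Or.inl (sub_eq_zero.1 h0)
    · exact Or.inr (by rw [← h0]; abel)
  have hne : e ≠ e + c₀ := fun h' => hc₀ (left_eq_add.1 h')
  obtain ⟨q, hq⟩ : 2 ∣ F.card := h (π e)
  have hle : F.card ≤ 2 := le_trans (card_le_card hsub) (by rw [card_pair hne])
  have hpos : 0 < F.card := card_pos.2 ⟨e, heF⟩
  have hF2 : F.card = 2 := by omega
  have hFeq : F = {e, e + c₀} := eq_of_subset_of_card_le hsub (by rw [card_pair hne, hF2])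
  have : e + c₀ ∈ F := by rw [hFeq]; exact mem_insert_of_mem (mem_singleton_self _)
  exact (mem_filter.1 this).1

omit [Fintype A] [DecidableEq A] in
/-- **Odd-weight transfer.**  `2^m · B = 0`, `Y ⊆ A` of odd size, `H : B → ℕ` with `∑_{y ∈ Y} H(z − π y)` even for
every `z ∈ B`: then every `H z` is even.  (In `𝔽₂[B]`, `(∑_{y∈Y} X^{πy}) · (∑_z H(z) X^z) = 0` and the first factor has odd
weight, hence is a unit by `eq_zero_of_mul_odd_weight`.) [folklore] -/
theorem even_of_odd_weight_convolution (π : A →+ B) {m : ℕ} (hB : ∀ b : B, (2 ^ m) • b = 0) {Y : Finset A}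
    (hY : Odd Y.card) (H : B → ℕ) (h : ∀ z : B, 2 ∣ ∑ y ∈ Y, H (z - π y)) : ∀ z : B, 2 ∣ H z := by
  -- fibre counts of `Y`
  set g : B → ZMod 2 := fun b => ((Y.filter fun y => π y = b).card : ZMod 2) with hg
  set f : B → ZMod 2 := fun b => (H b : ZMod 2) with hf
  have hgsum : ∑ b : B, g b = 1 := by
    have hnat : ∑ b : B, (Y.filter fun y => π y = b).card = Y.card :=
      (card_eq_sum_card_fiberwise (f := π) (s := Y) (t := univ) fun y _ => mem_univ _).symm
    have : ((∑ b : B, (Y.filter fun y => π y = b).card : ℕ) : ZMod 2) = (Y.card : ZMod 2) := by rw [hnat]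
    push_cast at this
    rw [hg, this]
    obtain ⟨k, hk⟩ := hY
    rw [hk]; push_cast
    rw [show (2 : ZMod 2) = 0 from rfl, zero_mul, zero_add]
  -- the convolution hypothesis, fibrewise
  have hconv : ∀ z : B, ∑ b : B, g b * f (z - b) = 0 := by
    intro z
    have hfib : ∑ y ∈ Y, H (z - π y) = ∑ b : B, (Y.filter fun y => π y = b).card * H (z - b) := by
      rw [← Finset.sum_fiberwise' Y π fun b => H (z - b)]
      refine sum_congr rfl fun b _ => ?_
      rw [sum_const, smul_eq_mul]
    have hcast : ((∑ y ∈ Y, H (z - π y) : ℕ) : ZMod 2) = 0 := (ZMod.natCast_eq_zero_iff _ 2).2 (h z)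
    rw [hfib] at hcast
    push_cast at hcast
    simpa only [hg, hf] using hcast
  -- in the group algebra
  set φg : AddMonoidAlgebra (ZMod 2) B := ∑ b : B, single b (g b) with hφg
  set φf : AddMonoidAlgebra (ZMod 2) B := ∑ b : B, single b (f b) with hφf
  have hprod : φf * φg = 0 := by
    rw [mul_comm]
    refine AddMonoidAlgebra.ext (Finsupp.ext fun z => ?_)
    rw [hφg, sum_mul, coeff_sum, Finsupp.finsetSum_apply, coeff_zero, Finsupp.zero_apply]
    have : ∀ b : B, ((single b (g b) : AddMonoidAlgebra (ZMod 2) B) * φf).coeff z = g b * f (z - b) := by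
      intro b
      rw [coeff_single_mul_apply, hφf, coeff_sum_single, neg_add_eq_sub]
    simp_rw [this]
    exact hconv z
  have hφf0 : φf = 0 := eq_zero_of_mul_odd_weight hB g hgsum φf hprod
  intro z
  have hz : f z = 0 := by
    have := congrArg (fun x : AddMonoidAlgebra (ZMod 2) B => x.coeff z) hφf0
    simpa only [hφf, coeff_sum_single, coeff_zero, Finsupp.zero_apply] using this
  exact (ZMod.natCast_eq_zero_iff _ 2).1 hz

omit [Fintype A] in
/-- **A periodic box `{s} + Y + W` with `|Y|` odd has `W` periodic.**  `π : A →+ B` with kernel `{0, c₀}` (`c₀ ≠ 0`),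
`2^m · B = 0`; if the box `{s} + Y + W` is injective and `c₀`-periodic and `|Y|` is odd, then `W + c₀ = W`. [folklore] -/
theorem periodic_of_periodic_box_odd (π : A →+ B) {c₀ : A} (hker : ∀ a : A, π a = 0 ↔ a = 0 ∨ a = c₀) (hc₀ : c₀ ≠ 0)
    {m : ℕ} (hB : ∀ b : B, (2 ^ m) • b = 0) {s : A} {Y W : Finset A} (hY : Odd Y.card)
    (hinj : Set.InjOn (fun p : A × A × A => p.1 + p.2.1 + p.2.2) ↑(({s} : Finset A) ×ˢ Y ×ˢ W))
    (hper : ((({s} : Finset A) ×ˢ Y ×ˢ W).image fun p : A × A × A => p.1 + p.2.1 + p.2.2).image (· + c₀) =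
      (({s} : Finset A) ×ˢ Y ×ˢ W).image fun p : A × A × A => p.1 + p.2.1 + p.2.2) :
    W.image (· + c₀) = W := by
  have hπc : π c₀ = 0 := (hker c₀).2 (Or.inr rfl)
  have h2c : c₀ + c₀ = 0 := by
    rcases (hker (c₀ + c₀)).1 (by rw [map_add, hπc, add_zero]) with h' | h'
    · exact h'
    · exact absurd (add_eq_left.1 h') hc₀
  set H : B → ℕ := fun b => (W.filter fun w => π w = b).card with hH
  have hev : ∀ z : B, 2 ∣ ∑ y ∈ Y, H (z - π y) := by
    intro z
    have := even_card_fibre_of_periodic π hπc hc₀ h2c hper (z + π s)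
    rw [card_fibre_box_eq_sum π hinj, sum_singleton] at this
    have e : ∀ y : A, z + π s - π s - π y = z - π y := fun y => by abel
    simpa only [hH, e] using this
  exact periodic_of_even_fibres π hker hc₀ (even_of_odd_weight_convolution π hB hY H hev)

end OddTransfer

/-! ## Class N2 -/

section N2

variable {A : Type} [AddCommGroup A] [DecidableEq A] [Fintype A] {G : Type} [Group G] [DecidableEq G]
  {ρ τ : A → G} {c₀ : A} {B : Type} [AddCommGroup B] [DecidableEq B] [Fintype B]

/-- **Normalised N2 lemma: both parts of `U` are periodic.**  Dicyclic type, `π : A →+ B` with kernel `{0,c₀}`, `B` a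
`2`-group; a TPP triple with `|S₀| = |S₁| = 1`, `|T₁|` odd and the vertex `111` exact
(`|T₁||U₁| + |T₀||U₁| + |T₁||U₀| = |A|`).  Then `U₀ + c₀ = U₀` and `U₁ + c₀ = U₁`. [folklore] -/
theorem n2_parts_periodic_aux
    (hρρ : ∀ a b, ρ a * ρ b = ρ (a + b)) (hρτ : ∀ a b, ρ a * τ b = τ (b - a))
    (hτρ : ∀ a b, τ a * ρ b = τ (a + b)) (hττ : ∀ a b, τ a * τ b = ρ (c₀ + b - a)) (hc₀ : c₀ ≠ 0)
    (hρ : Function.Injective ρ) (hτ : Function.Injective τ) (hne : ∀ a b, ρ a ≠ τ b)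
    (π : A →+ B) (hker : ∀ a : A, π a = 0 ↔ a = 0 ∨ a = c₀) {m : ℕ} (hB : ∀ b : B, (2 ^ m) • b = 0)
    {S T U : Finset G} (h : TripleProductProperty S T U)
    (hs₀ : (univ.filter fun a : A => ρ a ∈ S).card = 1) (hs₁ : (univ.filter fun a : A => τ a ∈ S).card = 1)
    (hodd : Odd (univ.filter fun a : A => τ a ∈ T).card)
    (hex : (univ.filter fun a : A => τ a ∈ T).card * (univ.filter fun a : A => τ a ∈ U).card +
      (univ.filter fun a : A => ρ a ∈ T).card * (univ.filter fun a : A => τ a ∈ U).card +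
      (univ.filter fun a : A => τ a ∈ T).card * (univ.filter fun a : A => ρ a ∈ U).card = Fintype.card A) :
    (univ.filter fun a : A => ρ a ∈ U).image (· + c₀) = (univ.filter fun a : A => ρ a ∈ U) ∧
    (univ.filter fun a : A => τ a ∈ U).image (· + c₀) = (univ.filter fun a : A => τ a ∈ U) := by
  set S₀ : Finset A := univ.filter fun a => ρ a ∈ S with hS₀
  set S₁ : Finset A := univ.filter fun a => τ a ∈ S with hS₁
  set T₀ : Finset A := univ.filter fun a => ρ a ∈ T with hT₀
  set T₁ : Finset A := univ.filter fun a => τ a ∈ T with hT₁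
  set U₀ : Finset A := univ.filter fun a => ρ a ∈ U with hU₀
  set U₁ : Finset A := univ.filter fun a => τ a ∈ U with hU₁
  have h2c := two_c0_eq_zero hρτ hτρ hττ hτ
  have mS₀ : ∀ a ∈ S₀, cond false (τ a) (ρ a) ∈ S := fun a ha => by simpa [hS₀] using ha
  have mS₁ : ∀ a ∈ S₁, cond true (τ a) (ρ a) ∈ S := fun a ha => by simpa [hS₁] using ha
  have mT₀ : ∀ a ∈ T₀, cond false (τ a) (ρ a) ∈ T := fun a ha => by simpa [hT₀] using ha
  have mT₁ : ∀ a ∈ T₁, cond true (τ a) (ρ a) ∈ T := fun a ha => by simpa [hT₁] using ha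
  have mU₀ : ∀ a ∈ U₀, cond false (τ a) (ρ a) ∈ U := fun a ha => by simpa [hU₀] using ha
  have mU₁ : ∀ a ∈ U₁, cond true (τ a) (ρ a) ∈ U := fun a ha => by simpa [hU₁] using ha
  have cs := card_sumset' hρρ hττ hρ hτ h
  have inj := sum_injOn' hρρ hττ hρ hτ h
  -- the vertex `111`: boxes `B011 = S₀+T₁+U₁`, `B101 = S₁+T₀+U₁`, `B110 = S₁+T₁+U₀`
  set B011 := (S₀ ×ˢ T₁ ×ˢ U₁).image fun p : A × A × A => p.1 + p.2.1 + p.2.2 with hB011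
  set B101 := (S₁ ×ˢ T₀ ×ˢ U₁).image fun p : A × A × A => p.1 + p.2.1 + p.2.2 with hB101
  set B110 := (S₁ ×ˢ T₁ ×ˢ U₀).image fun p : A × A × A => p.1 + p.2.1 + p.2.2 with hB110
  have d₁ : Disjoint B101 B011 := (disjoint_sumset₁' hρρ hρτ hτρ hττ hne h) true mS₁ mT₀ mU₁ mS₀ mT₁
  have d₂ : Disjoint B110 B101 := (disjoint_sumset₂' hρρ hρτ hτρ hττ hne h) true mS₁ mT₁ mU₀ mS₁ mT₀ mU₁
  have d₃ : Disjoint B011 B110 := (disjoint_sumset₃' hρρ hρτ hτρ hττ hne h) true mS₀ mT₁ mU₁ mS₁ mU₀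
  have sh₁ : Disjoint B101 (B011.image (· + c₀)) :=
    (disjoint_sumset₁_shift' hρρ hρτ hττ hne h) true mS₁ mT₀ mU₁ mS₀ mT₁
  have sh₂ : Disjoint (B101.image (· + c₀)) B110 :=
    (disjoint_sumset₂_shift' hρρ hρτ hττ hne h) true mS₁ mT₀ mU₁ mS₁ mT₁ mU₀
  have sh₃ : Disjoint B110 (B011.image (· + c₀)) :=
    (disjoint_sumset₃_shift' hρρ hρτ hτρ hττ hne h) true mS₁ mT₁ mU₀ mS₀ mU₁
  have c011 : B011.card = T₁.card * U₁.card := by rw [hB011, cs false true true mS₀ mT₁ mU₁, hs₀, one_mul]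
  have c101 : B101.card = T₀.card * U₁.card := by rw [hB101, cs true false true mS₁ mT₀ mU₁, hs₁, one_mul]
  have c110 : B110.card = T₁.card * U₀.card := by rw [hB110, cs true true false mS₁ mT₁ mU₀, hs₁, one_mul]
  have hcard : B011.card + B101.card + B110.card = Fintype.card A := by rw [c011, c101, c110, ← hex]
  have hper011 : B011.image (· + c₀) = B011 :=
    periodic_of_exact_vertex d₁.symm d₃ d₂.symm hcard sh₁.symm sh₃.symm
  have hper110 : B110.image (· + c₀) = B110 :=
    periodic_of_exact_vertex d₃.symm d₂ (by exact d₁.symm) (by rw [← hcard]; ring)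
      (disjoint_image_add_comm h2c sh₃) (disjoint_image_add_comm h2c (by exact sh₂.symm))
  -- `S₀ = {s₀}`, `S₁ = {s₁}`
  obtain ⟨s₀, hS₀eq⟩ := card_eq_one.1 hs₀
  obtain ⟨s₁, hS₁eq⟩ := card_eq_one.1 hs₁
  constructor
  · -- `B110 = {s₁} + T₁ + U₀`
    have hinj : Set.InjOn (fun p : A × A × A => p.1 + p.2.1 + p.2.2) ↑(({s₁} : Finset A) ×ˢ T₁ ×ˢ U₀) := by
      rw [← hS₁eq]; exact inj true true false mS₁ mT₁ mU₀
    have hper : (((({s₁} : Finset A) ×ˢ T₁ ×ˢ U₀).image fun p : A × A × A => p.1 + p.2.1 + p.2.2).image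
        (· + c₀)) = (({s₁} : Finset A) ×ˢ T₁ ×ˢ U₀).image fun p : A × A × A => p.1 + p.2.1 + p.2.2 := by
      rw [← hS₁eq]; exact hper110
    exact periodic_of_periodic_box_odd π hker hc₀ hB hodd hinj hper
  · -- `B011 = {s₀} + T₁ + U₁`
    have hinj : Set.InjOn (fun p : A × A × A => p.1 + p.2.1 + p.2.2) ↑(({s₀} : Finset A) ×ˢ T₁ ×ˢ U₁) := by
      rw [← hS₀eq]; exact inj false true true mS₀ mT₁ mU₁
    have hper : (((({s₀} : Finset A) ×ˢ T₁ ×ˢ U₁).image fun p : A × A × A => p.1 + p.2.1 + p.2.2).image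
        (· + c₀)) = (({s₀} : Finset A) ×ˢ T₁ ×ˢ U₁).image fun p : A × A × A => p.1 + p.2.1 + p.2.2 := by
      rw [← hS₀eq]; exact hper011
    exact periodic_of_periodic_box_odd π hker hc₀ hB hodd hinj hper

/-- From periodic parts to stability: if `U₀ + c₀ = U₀` and `U₁ + c₀ = U₁` then `U ρ(c₀) = U`. [folklore] -/
theorem stable_of_parts_periodic
    (hρρ : ∀ a b, ρ a * ρ b = ρ (a + b)) (hτρ : ∀ a b, τ a * ρ b = τ (a + b))
    (hsurj : ∀ g, (∃ a, ρ a = g) ∨ (∃ a, τ a = g)) {U : Finset G} {c : A}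
    (h₀ : (univ.filter fun a : A => ρ a ∈ U).image (· + c) = (univ.filter fun a : A => ρ a ∈ U))
    (h₁ : (univ.filter fun a : A => τ a ∈ U).image (· + c) = (univ.filter fun a : A => τ a ∈ U)) :
    ∀ x ∈ U, x * ρ c ∈ U := by
  intro x hx
  rcases hsurj x with ⟨b, rfl⟩ | ⟨b, rfl⟩
  · rw [hρρ]
    have hb : b ∈ (univ.filter fun a : A => ρ a ∈ U) := mem_filter.2 ⟨mem_univ _, hx⟩
    have : b + c ∈ (univ.filter fun a : A => ρ a ∈ U) := by rw [← h₀]; exact mem_image_of_mem _ hb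
    exact (mem_filter.1 this).2
  · rw [hτρ]
    have hb : b ∈ (univ.filter fun a : A => τ a ∈ U) := mem_filter.2 ⟨mem_univ _, hx⟩
    have : b + c ∈ (univ.filter fun a : A => τ a ∈ U) := by rw [← h₁]; exact mem_image_of_mem _ hb
    exact (mem_filter.1 this).2

/-- **No N2-class dicyclic-law triple when `A/⟨c₀⟩` is a `2`-group mapping onto `𝔽₂³`.**  Dicyclic type (`c₀ ≠ 0`),
`|A| ≡ 2 (mod 3)`, `|A| ≥ 28`, three homomorphisms `A →+ ZMod 2` killing `c₀` jointly onto `𝔽₂³`, `π : A →+ B` onto with kernel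
`{0, c₀}`, `2^m · B = 0`.  Then no TPP triple with `|S₀| = |S₁| = 1` and `|U₀| = |U₁| = 4` attains `3|S||T||U| + 16 = 8|A|`.
(The law gives `|A| = 6|T| + 2`; `8 ∣ |A|` gives `|T| ≡ 1 (mod 4)`; the vertices `000`/`111` give `||T₀| − |T₁|| ≤ 1`, so the
larger part of `T` is odd and its four vertices are exact; after a `τ0`-translation of `T` if necessary,
`n2_parts_periodic_aux` makes `U` `ρ(c₀)`-stable and `no_dicyclic_law_of_stable_member` concludes.) [folklore] -/
theorem no_n2_dicyclic_law
    (hρρ : ∀ a b, ρ a * ρ b = ρ (a + b)) (hρτ : ∀ a b, ρ a * τ b = τ (b - a))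
    (hτρ : ∀ a b, τ a * ρ b = τ (a + b)) (hττ : ∀ a b, τ a * τ b = ρ (c₀ + b - a)) (hc₀ : c₀ ≠ 0)
    (hρ : Function.Injective ρ) (hτ : Function.Injective τ) (hne : ∀ a b, ρ a ≠ τ b)
    (hsurj : ∀ g, (∃ a, ρ a = g) ∨ (∃ a, τ a = g)) (hmod : Fintype.card A % 3 = 2) (hA : 28 ≤ Fintype.card A)
    (ψ₁ ψ₂ ψ₃ : A →+ ZMod 2) (hψc : ψ₁ c₀ = 0 ∧ ψ₂ c₀ = 0 ∧ ψ₃ c₀ = 0)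
    (hψ : ∀ v : ZMod 2 × ZMod 2 × ZMod 2, ∃ x, (ψ₁ x, ψ₂ x, ψ₃ x) = v)
    (π : A →+ B) (hker : ∀ a : A, π a = 0 ↔ a = 0 ∨ a = c₀) {m : ℕ} (hB : ∀ b : B, (2 ^ m) • b = 0)
    {S T U : Finset G} (h : TripleProductProperty S T U)
    (hs₀ : (univ.filter fun a : A => ρ a ∈ S).card = 1) (hs₁ : (univ.filter fun a : A => τ a ∈ S).card = 1)
    (hu₀ : (univ.filter fun a : A => ρ a ∈ U).card = 4) (hu₁ : (univ.filter fun a : A => τ a ∈ U).card = 4) :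
    3 * (S.card * T.card * U.card) + 16 ≠ 8 * Fintype.card A := by
  intro hV
  have cS : S.card = 2 := by rw [card_eq_parts' hρ hτ hne hsurj S, hs₀, hs₁]
  have cU : U.card = 8 := by rw [card_eq_parts' hρ hτ hne hsurj U, hu₀, hu₁]
  have cT := card_eq_parts' hρ hτ hne hsurj T
  have h8 : 8 ∣ Fintype.card A := eight_dvd_card_of_onto ψ₁ ψ₂ ψ₃ hψ
  obtain ⟨h000, h111, -⟩ := vertex_counting' hρρ hρτ hτρ hττ hρ hτ hne h
  rw [hs₀, hs₁, hu₀, hu₁] at h000 h111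
  rw [cS, cT, cU] at hV
  set t₀ := (univ.filter fun a : A => ρ a ∈ T).card with ht₀
  set t₁ := (univ.filter fun a : A => τ a ∈ T).card with ht₁
  obtain ⟨q, hq⟩ := h8
  have h2c := two_c0_eq_zero hρτ hτρ hττ hτ
  -- the two orientations of `T`
  have key : (univ.filter fun a : A => ρ a ∈ U).image (· + c₀) = (univ.filter fun a : A => ρ a ∈ U) ∧
      (univ.filter fun a : A => τ a ∈ U).image (· + c₀) = (univ.filter fun a : A => τ a ∈ U) := by
    by_cases hcase : t₁ = t₀ + 1
    · have hodd : Odd t₁ := ⟨t₀ / 2, by omega⟩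
      exact n2_parts_periodic_aux hρρ hρτ hτρ hττ hc₀ hρ hτ hne π hker hB h hs₀ hs₁ hodd
        (by rw [hu₀, hu₁]; omega)
    · have hcase' : t₀ = t₁ + 1 := by omega
      -- translate `T` by `τ0`: the parts swap
      have er : (Equiv.mulRight (1 : G)).toEmbedding = Function.Embedding.refl G := by ext x; simp
      have h' : TripleProductProperty S (T.map (Equiv.mulRight (τ 0)).toEmbedding) U := by
        have := h.map_mulRight 1 (τ 0) 1; simpa only [er, Finset.map_refl] using this
      have cT'₀ := card_rho_part_mulRight_tau hρρ hρτ hττ (A := A) T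
      have cT'₁ := card_tau_part_mulRight_tau hρρ hττ (A := A) T
      have hodd : Odd (univ.filter fun a : A => τ a ∈ T.map (Equiv.mulRight (τ 0)).toEmbedding).card := by
        rw [cT'₁]; exact ⟨t₁ / 2, by omega⟩
      exact n2_parts_periodic_aux hρρ hρτ hτρ hττ hc₀ hρ hτ hne π hker hB h' hs₀ hs₁ hodd
        (by rw [cT'₀, cT'₁, hu₀, hu₁]; omega)
  obtain ⟨hU₀, hU₁⟩ := key
  have hstab : ∀ x ∈ U, x * ρ c₀ ∈ U := stable_of_parts_periodic hρρ hτρ hsurj hU₀ hU₁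
  have hV' : 3 * (S.card * T.card * U.card) + 16 = 8 * Fintype.card A := by rw [cS, cT, cU]; exact hV
  exact no_dicyclic_law_of_stable_member hρρ hρτ hτρ hττ hc₀ hρ hτ hne hsurj hmod hA ψ₁ ψ₂ ψ₃ hψc hψ h h2c hc₀
    (Or.inr (Or.inr hstab)) hV'

end N2

end Summit.MatrixMultiplication.OmegaCensus
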